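import Literature.Probability.Process.BrownianVecHarmonic
import Literature.Probability.Process.HittingFrom
import HarnessLib

/-!
# Hitting times after a deterministic time for `d`-dimensional Brownian motion; optional stopping between `s₀` and the next hitting time

Topic `Probability/Process`; one small definition (`hitFrom`, the tree's `hittingFrom` at a
constant time) and theorems, no named fact. For a `d`-dimensional Brownian motion `W`
(`IsBrownianVec`) and a closed set `F`:

* `IsBrownianVec.hitFrom W F s₀` — the first hitting time of `F` by `W` at or after `s₀`, a
  stopping time of the natural filtration (`isStoppingTime_hitFrom`, from the tree's
  `isStoppingTime_hittingFrom`), with its elementary API (`le_hitFrom`, `hitFrom_le_of_mem`,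
  `hitFrom_eq_of_mem`, `notMem_of_lt_hitFrom`, `mem_of_hitFrom_eq_coe`, `hitFrom_ne_top_iff`,
  `hitFrom_anti`, `hitFrom_mono_start`, `min_hitFrom_union_eq`, `mem_closure_compl_of_le_hitFrom`);
* `IsBrownianVec.integral_indicator_stoppedProcess_hitFrom_sub_eq_zero` — **harmonic functions
  of Brownian motion between a deterministic time and the next hitting time**: for `U` open,
  `V ∈ C²(U)` harmonic on `U`, `F` closed with bounded complement and `closure Fᶜ ⊆ U`, `s₀ ≤ t`
  and `τ` the hitting time of `F` after `s₀`,
  `E[𝟙{W_{s₀} ∉ F} (V(W_{t ∧ τ}) − V(W_{s₀}))] = 0`.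
  Optional stopping for Dynkin's martingale (`integral_stoppedProcess_dynkin`) of a `C²_c`
  cutoff of `V` at the two stopping times `s₀ ≤ τ`; NO Markov property is used (this replaces
  "restart at time `s₀` from `W_{s₀}`" in exit problems started at a polar point, e.g. the
  Brownian bubble hitting masses of `RandomPlanarGeometry/BubbleHittingMass`).

## References

* J.-F. Le Gall, *Brownian Motion, Martingales, and Stochastic Calculus*, GTM 274 (2016), Ch. 7
  §7.2 (harmonic functions and exit problems via Dynkin/Itô and optional stopping). [Legall2016]
* D. Revuz, M. Yor, *Continuous Martingales and Brownian Motion* (1999), Ch. I Prop. (4.6)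
  (hitting times of closed sets are stopping times). [RevuzYor1999]
-/

noncomputable section

open MeasureTheory ProbabilityTheory Filter Topology Set Metric
open scoped NNReal ENNReal

namespace Literature.Probability.Process

variable {Ω : Type*} {mΩ : MeasurableSpace Ω} {P : Measure Ω} {d : ℕ}

namespace IsBrownianVec

variable {W : ℝ≥0 → Ω → (Fin d → ℝ)}

/-! ### The hitting time of a closed set after a deterministic time -/

/-- **The first hitting time of `F` by `W` at or after the deterministic time `s₀`** (the tree's
`hittingFrom` with the constant random time `s₀`). [folklore] -/
def hitFrom (W : ℝ≥0 → Ω → (Fin d → ℝ)) (F : Set (Fin d → ℝ)) (s₀ : ℝ≥0) : Ω → WithTop ℝ≥0 :=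
  hittingFrom (fun t ω ↦ W t ω) F fun _ ↦ (s₀ : WithTop ℝ≥0)

/-- `hitFrom` is a stopping time of the natural filtration (closed `F`). [cite: RevuzYor1999, Ch. I Prop. (4.6)] -/
theorem isStoppingTime_hitFrom (hW : IsBrownianVec W P) {F : Set (Fin d → ℝ)} (hF : IsClosed F)
    (s₀ : ℝ≥0) : IsStoppingTime hW.natFiltration (hitFrom W F s₀) :=
  isStoppingTime_hittingFrom (fun t ↦ hW.measurable_apply_le (le_refl t)) hW.continuous_path hF
    (isStoppingTime_const _ _)

/-- `s₀ ≤ hitFrom W F s₀`. [folklore] -/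
theorem le_hitFrom (F : Set (Fin d → ℝ)) (s₀ : ℝ≥0) (ω : Ω) : (s₀ : WithTop ℝ≥0) ≤ hitFrom W F s₀ ω :=
  le_hittingFrom (T := fun _ ↦ (s₀ : WithTop ℝ≥0))

/-- A visit of `F` at a time `j ≥ s₀` bounds `hitFrom` by `j`. [folklore] -/
theorem hitFrom_le_of_mem {F : Set (Fin d → ℝ)} {s₀ j : ℝ≥0} {ω : Ω} (hj : s₀ ≤ j) (h : W j ω ∈ F) :
    hitFrom W F s₀ ω ≤ j :=
  hittingFrom_le_of_mem (T := fun _ ↦ (s₀ : WithTop ℝ≥0)) (by exact_mod_cast hj) h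

/-- If `W_{s₀} ∈ F` then `hitFrom W F s₀ = s₀`. [folklore] -/
theorem hitFrom_eq_of_mem {F : Set (Fin d → ℝ)} {s₀ : ℝ≥0} {ω : Ω} (h : W s₀ ω ∈ F) :
    hitFrom W F s₀ ω = s₀ :=
  le_antisymm (hitFrom_le_of_mem le_rfl h) (le_hitFrom F s₀ ω)

/-- Before `hitFrom` (and after `s₀`) the path is off `F`. [folklore] -/
theorem notMem_of_lt_hitFrom {F : Set (Fin d → ℝ)} {s₀ r : ℝ≥0} {ω : Ω} (hr : s₀ ≤ r)
    (h : (r : WithTop ℝ≥0) < hitFrom W F s₀ ω) : W r ω ∉ F :=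
  notMem_of_lt_hittingFrom (T := fun _ ↦ (s₀ : WithTop ℝ≥0)) (by exact_mod_cast hr) h

/-- At a finite `hitFrom` the path is in `F` (closed `F`, continuous paths). [folklore] -/
theorem mem_of_hitFrom_eq_coe (hW : IsBrownianVec W P) {F : Set (Fin d → ℝ)} (hF : IsClosed F)
    {s₀ T : ℝ≥0} {ω : Ω} (h : hitFrom W F s₀ ω = T) : W T ω ∈ F :=
  mem_of_hittingFrom_eq_coe (T := fun _ ↦ (s₀ : WithTop ℝ≥0)) hF (hW.continuous_path ω) h

/-- `hitFrom` is finite iff `F` is visited at some time `≥ s₀`. [folklore] -/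
theorem hitFrom_ne_top_iff {F : Set (Fin d → ℝ)} {s₀ : ℝ≥0} {ω : Ω} :
    hitFrom W F s₀ ω ≠ ⊤ ↔ ∃ j : ℝ≥0, s₀ ≤ j ∧ W j ω ∈ F := by
  rw [hitFrom, hittingFrom_ne_top_iff]
  simp only [WithTop.coe_le_coe]

/-- A larger set is hit earlier. [folklore] -/
theorem hitFrom_anti {F G : Set (Fin d → ℝ)} (hFG : F ⊆ G) (s₀ : ℝ≥0) (ω : Ω) (hW : IsBrownianVec W P)
    (hF : IsClosed F) : hitFrom W G s₀ ω ≤ hitFrom W F s₀ ω := by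
  induction h : hitFrom W F s₀ ω with
  | top => exact le_top
  | coe T =>
    have hmem : W T ω ∈ F := hW.mem_of_hitFrom_eq_coe hF h
    have hT : (s₀ : WithTop ℝ≥0) ≤ T := by rw [← h]; exact le_hitFrom F s₀ ω
    exact hitFrom_le_of_mem (by exact_mod_cast hT) (hFG hmem)

/-- **Up to `t ∧ hitFrom` (from `s₀` on) the path stays in `closure Fᶜ`**, if `W_{s₀} ∉ F`. [folklore] -/
theorem mem_closure_compl_of_le_hitFrom (hW : IsBrownianVec W P) {F : Set (Fin d → ℝ)} (hF : IsClosed F)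
    {s₀ : ℝ≥0} {ω : Ω} (h0 : W s₀ ω ∉ F) (t : ℝ≥0) {r : ℝ≥0} (hr1 : s₀ ≤ r)
    (hr2 : r ≤ (min (t : WithTop ℝ≥0) (hitFrom W F s₀ ω)).untopA) : W r ω ∈ closure Fᶜ := by
  have hcont : Continuous fun s : ℝ≥0 ↦ W s ω := hW.continuous_path ω
  by_cases hlt : (r : WithTop ℝ≥0) < hitFrom W F s₀ ω
  · exact subset_closure (notMem_of_lt_hitFrom hr1 hlt)
  · induction hT : hitFrom W F s₀ ω with
    | top => exact absurd (hT ▸ WithTop.coe_lt_top r) hlt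
    | coe T₀ =>
      rw [hT] at hlt hr2
      rw [untopA_min_coe_coe] at hr2
      have hrT : r = T₀ := le_antisymm (hr2.trans (min_le_right _ _)) (not_lt.1 (by exact_mod_cast hlt))
      subst hrT
      have hmem : W r ω ∈ F := hW.mem_of_hitFrom_eq_coe hF hT
      -- `s₀ < r` since `W_{s₀} ∉ F`
      have hs₀r : s₀ < r := lt_of_le_of_ne hr1 fun h ↦ h0 (h ▸ hmem)
      have hS : IsClosed {s : ℝ≥0 | W s ω ∈ closure Fᶜ} := isClosed_closure.preimage hcont
      have hsub : Ico s₀ r ⊆ {s : ℝ≥0 | W s ω ∈ closure Fᶜ} := fun s hs ↦ by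
        have hs' : (s : WithTop ℝ≥0) < hitFrom W F s₀ ω := by rw [hT]; exact_mod_cast hs.2
        exact subset_closure (notMem_of_lt_hitFrom hs.1 hs')
      have hcl : closure (Ico s₀ r) ⊆ {s : ℝ≥0 | W s ω ∈ closure Fᶜ} := closure_minimal hsub hS
      apply hcl
      rw [closure_Ico hs₀r.ne]
      exact ⟨hs₀r.le, le_rfl⟩

/-! ### Optional stopping between `s₀` and the hitting time after `s₀` -/

/-- **Harmonic functions of Brownian motion between a deterministic time and the next hitting
time.** Let `U ⊆ ℝᵈ` be open, `V ∈ C²(U)` with `ΔV = 0` on `U`, `F` closed with bounded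
complement and `closure Fᶜ ⊆ U`, `s₀ ≤ t`, and `τ` the hitting time of `F` by `W` at or after
`s₀`. Then

  `E[𝟙{W_{s₀} ∉ F} · (V(W_{t ∧ τ}) − V(W_{s₀}))] = 0`.

Optional stopping for Dynkin's martingale of a `C²_c` cutoff of `V` at the two stopping times
`s₀ ≤ τ`: between them the path stays in `closure Fᶜ`, where the cutoff agrees with `V` and is
harmonic; on `{W_{s₀} ∈ F}` one has `τ = s₀` and the increment vanishes. No Markov property is
used. [cite: Legall2016, Ch. 7 §7.2, proof of Prop. 7.3] -/
theorem integral_indicator_stoppedProcess_hitFrom_sub_eq_zero [IsProbabilityMeasure P]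
    (hW : IsBrownianVec W P) {U : Set (Fin d → ℝ)} (hU : IsOpen U) {V : (Fin d → ℝ) → ℝ}
    (hV : ContDiffOn ℝ 2 V U) (hΔ : ∀ y ∈ U, lap V y = 0) {F : Set (Fin d → ℝ)} (hF : IsClosed F)
    (hbdd : Bornology.IsBounded Fᶜ) (hFU : closure Fᶜ ⊆ U) {s₀ t : ℝ≥0} (hst : s₀ ≤ t) :
    Integrable (fun ω ↦ {ω | W s₀ ω ∉ F}.indicator
      (fun ω ↦ stoppedProcess (fun r ω ↦ V (W r ω)) (hitFrom W F s₀) t ω - V (W s₀ ω)) ω) P ∧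
    ∫ ω, {ω | W s₀ ω ∉ F}.indicator
      (fun ω ↦ stoppedProcess (fun r ω ↦ V (W r ω)) (hitFrom W F s₀) t ω - V (W s₀ ω)) ω ∂P = 0 := by
  set K : Set (Fin d → ℝ) := closure Fᶜ with hKdef
  have hK : IsCompact K := Metric.isCompact_of_isClosed_isBounded isClosed_closure hbdd.closure
  obtain ⟨χ, hχ, hχc, hχU, O, hO, hKO, hOU, hχ1⟩ := exists_contDiff_cutoff hK hU hFU
  set g : (Fin d → ℝ) → ℝ := fun y ↦ χ y * V y with hgdef
  have hgV : ∀ y ∈ O, g =ᶠ[𝓝 y] V := fun y hy ↦ by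
    filter_upwards [hO.mem_nhds hy] with z hz
    simp [hgdef, hχ1 z hz]
  have hg2 : ContDiff ℝ 2 g := by
    rw [contDiff_iff_contDiffAt]
    intro y
    by_cases hy : y ∈ U
    · exact (hχ.contDiffAt).mul (hV.contDiffAt (hU.mem_nhds hy))
    · have hy' : y ∉ tsupport χ := fun h ↦ hy (hχU h)
      have h0 : g =ᶠ[𝓝 y] fun _ ↦ 0 := by
        filter_upwards [(isClosed_tsupport χ).isOpen_compl.mem_nhds hy'] with z hz
        simp [hgdef, image_eq_zero_of_notMem_tsupport hz]
      exact (contDiffAt_const (c := (0 : ℝ))).congr_of_eventuallyEq h0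
  have hgc : HasCompactSupport g := hχc.mul_right
  have hlapg : ∀ y ∈ O, lap g y = 0 := fun y hy ↦ by
    rw [lap_congr_of_eventuallyEq (hgV y hy)]
    exact hΔ y (hOU hy)
  have hgK : ∀ y ∈ K, g y = V y := fun y hy ↦ by simp [hgdef, hχ1 y (hKO hy)]
  -- optional stopping at `τ` and at `s₀`
  obtain ⟨hint1, h01⟩ := hW.integral_stoppedProcess_dynkin hg2 hgc 0 (hW.isStoppingTime_hitFrom hF s₀) t
  obtain ⟨hint2, h02⟩ := hW.integral_stoppedProcess_dynkin hg2 hgc 0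
    (isStoppingTime_const hW.natFiltration (s₀ : ℝ≥0)) t
  -- the pathwise identity
  have hpath : ∀ ω, stoppedProcess (dynkin g 0 W) (hitFrom W F s₀) t ω -
      stoppedProcess (dynkin g 0 W) (fun _ ↦ ((s₀ : ℝ≥0) : WithTop ℝ≥0)) t ω =
      {ω | W s₀ ω ∉ F}.indicator
        (fun ω ↦ stoppedProcess (fun r ω ↦ V (W r ω)) (hitFrom W F s₀) t ω - V (W s₀ ω)) ω := by
    intro ω
    simp only [stoppedProcess]
    have hmin : (min (t : WithTop ℝ≥0) ((s₀ : ℝ≥0) : WithTop ℝ≥0)).untopA = s₀ := by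
      rw [min_eq_right (by exact_mod_cast hst)]; rfl
    rw [hmin]
    set σ : ℝ≥0 := (min (t : WithTop ℝ≥0) (hitFrom W F s₀ ω)).untopA with hσ
    have hσs : s₀ ≤ σ := by
      rw [hσ]
      have h1 : ((s₀ : ℝ≥0) : WithTop ℝ≥0) ≤ min (t : WithTop ℝ≥0) (hitFrom W F s₀ ω) :=
        le_min (by exact_mod_cast hst) (le_hitFrom F s₀ ω)
      have h2 : min (t : WithTop ℝ≥0) (hitFrom W F s₀ ω) ≠ ⊤ :=
        ne_top_of_le_ne_top WithTop.coe_ne_top (min_le_left _ _)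
      obtain ⟨m, hm⟩ := WithTop.ne_top_iff_exists.1 h2
      rw [← hm] at h1 ⊢
      show s₀ ≤ m
      exact_mod_cast h1
    rw [hW.dynkin_sub hg2 ω]
    by_cases hF0 : W s₀ ω ∈ F
    · -- then `τ = s₀`, `σ = s₀`
      have hτ : hitFrom W F s₀ ω = s₀ := hitFrom_eq_of_mem hF0
      have hσ0 : σ = s₀ := by rw [hσ, hτ, min_eq_right (by exact_mod_cast hst)]; rfl
      rw [indicator_of_notMem (by simpa using hF0), hσ0]
      simp
    · rw [indicator_of_mem (by simpa using hF0)]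
      have hmemK : ∀ r : ℝ≥0, s₀ ≤ r → r ≤ σ → W r ω ∈ K := fun r hr1 hr2 ↦
        hW.mem_closure_compl_of_le_hitFrom hF hF0 t hr1 hr2
      have hI : ∫ r in (s₀ : ℝ)..σ, lap g (0 + W r.toNNReal ω) = 0 := by
        rw [intervalIntegral.integral_congr (g := fun _ ↦ (0 : ℝ)) fun r hr ↦ ?_,
          intervalIntegral.integral_zero]
        rw [uIcc_of_le (by exact_mod_cast hσs)] at hr
        simp only [zero_add]
        refine hlapg _ (hKO (hmemK _ ?_ (Real.toNNReal_le_iff_le_coe.2 hr.2)))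
        exact Real.le_toNNReal_iff_coe_le (s₀.coe_nonneg.trans hr.1) |>.2 hr.1
      rw [hI, zero_add, zero_add, hgK _ (hmemK σ hσs le_rfl), hgK _ (hmemK s₀ le_rfl hσs)]
      ring
  have heq : (fun ω ↦ {ω | W s₀ ω ∉ F}.indicator
      (fun ω ↦ stoppedProcess (fun r ω ↦ V (W r ω)) (hitFrom W F s₀) t ω - V (W s₀ ω)) ω) =
      fun ω ↦ stoppedProcess (dynkin g 0 W) (hitFrom W F s₀) t ω -
        stoppedProcess (dynkin g 0 W) (fun _ ↦ ((s₀ : ℝ≥0) : WithTop ℝ≥0)) t ω := by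
    funext ω; exact (hpath ω).symm
  refine ⟨?_, ?_⟩
  · rw [heq]; exact hint1.sub hint2
  · rw [heq, integral_sub hint1 hint2, h01, h02, sub_zero]

end IsBrownianVec

end Literature.Probability.Process

end
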